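import Literature.Geometry.Lorentzian.TeukolskyRealAxisModeStability
import Literature.Geometry.Lorentzian.KerrStarChartBounds
import Literature.Geometry.Lorentzian.KerrSurfaceGravity
import Mathlib.Analysis.SpecialFunctions.Pow.Deriv
import Mathlib.Analysis.SpecialFunctions.Complex.Analytic
import HarnessLib

/-!
# The radial Teukolsky ODE on subextremal Kerr in confluent Heun form
# (Teixeira da Costa 2020, §3.2: the auxiliary function `g` and the operator `𝒯_r`)

Second file of the proof programme for the named fact
`Literature.Geometry.Lorentzian.Kerr.Costa2019_realAxisModeStability`
(`TeukolskyRealAxisModeStability.lean`; R. Teixeira da Costa, Commun. Math. Phys. 378 (2020)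
705–781 = arXiv:1910.02854 [Costa2019], Thm. 4.1), following the printed proof: the case
`s ≤ 0` rests on Whiting's integral transformation `R ↦ ũ` (Prop. 3.8), whose first step
(§3.2, (def-eta-xi-gamma), (def-g-sub), §3.2.2 (confluent-operator)) is to strip the
singular behaviour off an outgoing solution `R` of the radial ODE: with
`ξ := i(am − 2Mr₊ω)/(r₊ − r₋)` (`= Kerr.horizonExponent`), `η := i(2Mr₋ω − am)/(r₊ − r₋)`,
`γ := −iω`, `L := λ + a²ω² − 2amω`, the function
`g(r) := (r − r₋)^{−η+s} (r − r₊)^{−ξ+s} e^{−γr} R(r)` satisfies the confluent Heun equation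
`𝒯_r g = 0`,
`𝒯_r = Δ d²/dr² + [(2η+1−s)(r−r₊) + (2ξ+1−s)(r−r₋) + 2γΔ] d/dr + [2γ(1−2s) r − 2s − L]`.

Everything is proved (definitions with bodies + theorems; no named facts):

* `Costa2019.innerExponent` (`η`), `Costa2019.horizonExponent_eq` (`ξ` in the form of §3.2)
  (the horizon-radii algebra `r₊ + r₋ = 2M`, `r₊r₋ = a²`, `r₊ > 0` is `Kerr.rPlus_add_rMinus`,
  `Kerr.rPlus_mul_rMinus` of `KerrStarChartBounds.lean` and `Kerr.rPlus_pos` of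
  `KerrSurfaceGravity.lean`);
* `Costa2019.heunWeight` (`(r−r₋)^{s−η}(r−r₊)^{s−ξ}e^{iωr}`, so that `g = heunWeight · R`),
  `Costa2019.heunPsi` (its logarithmic derivative `ψ = (s−η)/(r−r₋) + (s−ξ)/(r−r₊) + iω`),
  `Costa2019.heunPsiDeriv` (`ψ'`), `Costa2019.heunP`, `Costa2019.heunQ` (the coefficients of
  `𝒯_r`), with `hasDerivAt_heunWeight`, `hasDerivAt_heunPsi`;
* the two coefficient identities behind "`R` solves the radial ODE ⇔ `𝒯_r g = 0`":
  `2Δψ + P = 2(s+1)(r−M)` (`two_delta_mul_heunPsi_add_heunP`) and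
  `Δ(ψ' + ψ²) + Pψ + Q = V` (`heun_zeroth_order_identity`, `V` the coefficient of `R` in
  `Kerr.IsRadialTeukolskySolution`) — rational identities in `(r, r₊, r₋, a, ω, m, s)` once
  `r₊ + r₋ = 2M`, `r₊r₋ = a²`, `Δ = (r−r₊)(r−r₋)` are used;
* `heunEquation_of_isRadialTeukolskySolution`: for a classical solution `R` on `(r₊, ∞)`,
  `g = heunWeight · R` is twice differentiable there with explicit `g', g''` and `𝒯_r g = 0`;
* `heunWeight_mul_smooth_at_horizon`: the outgoing condition at `𝓗⁺`
  (`Kerr.IsOutgoingAtHorizon`: `R(r−r₊)^{s−ξ}` smooth at `r₊`) makes `g` agree on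
  `(r₊, r₊+ε)` with a function smooth on a neighbourhood of `r₊` (TdC (g-bdry-sub), first
  line: "`g = Σ bₖ (r−r₊)ᵏ` as `r → r₊`", in `C^∞` form).

**Erratum recorded.** The zeroth-order coefficient of `𝒯_r` as it appears in [Costa2019,
§3.2.2, (confluent-operator)] (arXiv version, as read for this file) is
`2γ(1−2s)(r−r₋) + 2γ(1−s)r₋ − 2s − L`; the coefficient for which
`𝒯_r g = 0` is equivalent to the radial ODE (2.x)/(radial-ODE) as printed (and vendored) is
`2γ(1−2s) r − 2s − L` (the two differ by the constant `2γ s r₋`; they agree for `s = 0`, the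
case of Shlapentokh-Rothman 2015). `Costa2019.heunQ` is the corrected coefficient, and
`heun_zeroth_order_identity` is its machine-checked justification.

## References
* R. Teixeira da Costa, CMP 378 (2020) 705–781, arXiv:1910.02854, §3.2. [Costa2019]
* Y. Shlapentokh-Rothman, Ann. Henri Poincaré 16 (2015) 289–345, §4 (the case `s = 0`).
  [ShlapentokhRothman2015ModeStability]
-/

noncomputable section

open Complex Set

namespace Literature.Geometry.Lorentzian.Kerr

namespace Costa2019

/-! ### The exponents `ξ`, `η` of TdC §3.2 -/

/-- Teixeira da Costa's exponent at the Cauchy horizon,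
`η := i (2Mr₋ω − am)/(r₊ − r₋)`. [cite: Costa2019, §3.2 (def-eta-xi-gamma)] -/
def innerExponent (M a ω m : ℝ) : ℂ :=
  I * (((2 * M * rMinus M a * ω - a * m) / (rPlus M a - rMinus M a) : ℝ) : ℂ)

/-- The horizon exponent `ξ = −i (2Mr₊/(r₊−r₋))(ω − mω₊)` of §2.2.1 (`Kerr.horizonExponent`) in
the form of §3.2: `ξ = i(am − 2Mr₊ω)/(r₊ − r₋)` (using `ω₊ = a/(2Mr₊)`).
[cite: Costa2019, §2.2.1 (xi-upomega+) and §3.2 (def-eta-xi-gamma)] -/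
theorem horizonExponent_eq {M a : ℝ} (hM : 0 < M) (ha : |a| < M) (ω m : ℝ) :
    horizonExponent M a ω m =
      I * (((a * m - 2 * M * rPlus M a * ω) / (rPlus M a - rMinus M a) : ℝ) : ℂ) := by
  have hr : rPlus M a ≠ 0 := (rPlus_pos hM a).ne'
  have hd : rPlus M a - rMinus M a ≠ 0 :=
    (sub_pos.2 (IsSubextremal.rMinus_lt_rPlus ha)).ne'
  have hM0 : M ≠ 0 := hM.ne'
  unfold horizonExponent horizonAngularVelocity
  have h : (2 * M * rPlus M a / (rPlus M a - rMinus M a) * (ω - m * (a / (2 * M * rPlus M a)))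
      : ℝ) = -((a * m - 2 * M * rPlus M a * ω) / (rPlus M a - rMinus M a)) := by
    field_simp
    ring
  rw [h]
  push_cast
  ring

/-! ### The weight, its logarithmic derivative, and the coefficients of `𝒯_r` -/

/-- The logarithmic derivative `ψ = (s − η)/(r − r₋) + (s − ξ)/(r − r₊) + iω` of the weight
`(r−r₋)^{s−η}(r−r₊)^{s−ξ}e^{iωr}`. [cite: Costa2019, §3.2 (def-g-sub)] -/
def heunPsi (M a s ω m : ℝ) (r : ℝ) : ℂ :=
  ((s : ℂ) - innerExponent M a ω m) / ((r - rMinus M a : ℝ) : ℂ) +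
    ((s : ℂ) - horizonExponent M a ω m) / ((r - rPlus M a : ℝ) : ℂ) + I * ω

/-- `ψ' = −(s − η)/(r − r₋)² − (s − ξ)/(r − r₊)²`. [cite: Costa2019, §3.2 (def-g-sub)] -/
def heunPsiDeriv (M a s ω m : ℝ) (r : ℝ) : ℂ :=
  -((s : ℂ) - innerExponent M a ω m) / ((r - rMinus M a : ℝ) : ℂ) ^ 2 -
    ((s : ℂ) - horizonExponent M a ω m) / ((r - rPlus M a : ℝ) : ℂ) ^ 2

/-- The weight `(r − r₋)^{s−η} (r − r₊)^{s−ξ} e^{iωr}` (`= (r−r₋)^{−η+s}(r−r₊)^{−ξ+s}e^{−γr}`,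
`γ = −iω`) turning an outgoing radial solution `R` into TdC's auxiliary function
`g = heunWeight · R` (principal complex powers of the positive reals `r − r±`, `r > r₊`).
[cite: Costa2019, §3.2 (def-g-sub)] -/
def heunWeight (M a s ω m : ℝ) (r : ℝ) : ℂ :=
  ((r - rMinus M a : ℝ) : ℂ) ^ ((s : ℂ) - innerExponent M a ω m) *
    ((r - rPlus M a : ℝ) : ℂ) ^ ((s : ℂ) - horizonExponent M a ω m) * Complex.exp (I * ω * r)

/-- The first-order coefficient of the confluent Heun operator `𝒯_r`:
`P(r) = (2η + 1 − s)(r − r₊) + (2ξ + 1 − s)(r − r₋) + 2γΔ`, `γ = −iω`.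
[cite: Costa2019, §3.2.2 (confluent-operator)] -/
def heunP (M a s ω m : ℝ) (r : ℝ) : ℂ :=
  (2 * innerExponent M a ω m + 1 - s) * ((r - rPlus M a : ℝ) : ℂ) +
    (2 * horizonExponent M a ω m + 1 - s) * ((r - rMinus M a : ℝ) : ℂ) +
    2 * (-I * ω) * (delta M a r : ℂ)

/-- The zeroth-order coefficient of `𝒯_r`: `Q(r) = 2γ(1 − 2s) r − 2s − L`,
`L = λ + a²ω² − 2amω`, `γ = −iω`. (Corrected from the printed
`2γ(1−2s)(r−r₋) + 2γ(1−s)r₋ − 2s − L`, see the module docstring; both agree for `s = 0`.)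
[cite: Costa2019, §3.2.2 (confluent-operator), corrected] -/
def heunQ (a s ω m lam : ℝ) (r : ℝ) : ℂ :=
  2 * (-I * ω) * (1 - 2 * (s : ℂ)) * r - 2 * s - ((lam + a ^ 2 * ω ^ 2 - 2 * a * m * ω : ℝ) : ℂ)

/-! ### Calculus of the weight -/

/-- `d/dx (x − c)^p = (x − c)^p · p/(x − c)` for `x > c` (principal complex power of a
positive real). [folklore] -/
theorem hasDerivAt_ofReal_sub_cpow (c : ℝ) (p : ℂ) {r : ℝ} (hr : c < r) :
    HasDerivAt (fun x : ℝ => ((x - c : ℝ) : ℂ) ^ p)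
      (((r - c : ℝ) : ℂ) ^ p * (p / ((r - c : ℝ) : ℂ))) r := by
  have hpos : (0 : ℝ) < r - c := sub_pos.2 hr
  have hslit : ((r : ℂ) - c) ∈ slitPlane := by
    rw [← Complex.ofReal_sub]
    exact Complex.ofReal_mem_slitPlane.2 hpos
  have hne : ((r - c : ℝ) : ℂ) ≠ 0 := by exact_mod_cast hpos.ne'
  have h1 : HasDerivAt (fun z : ℂ => (z - c) ^ p) (p * ((r : ℂ) - c) ^ (p - 1) * 1) (r : ℂ) :=
    ((hasDerivAt_id (r : ℂ)).sub_const (c : ℂ)).cpow_const hslit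
  have hfun : (fun x : ℝ => ((x - c : ℝ) : ℂ) ^ p) = fun y : ℝ => ((y : ℂ) - c) ^ p := by
    funext y
    rw [Complex.ofReal_sub]
  rw [hfun]
  refine h1.comp_ofReal.congr_deriv ?_
  rw [mul_one, ← Complex.ofReal_sub, Complex.cpow_sub _ _ hne, Complex.cpow_one]
  field_simp

/-- `d/dx (x − c)⁻¹ = −((x − c)²)⁻¹` for `x > c` (complex-valued). [folklore] -/
theorem hasDerivAt_ofReal_sub_inv (c : ℝ) {r : ℝ} (hr : c < r) :
    HasDerivAt (fun x : ℝ => (((x - c : ℝ) : ℂ))⁻¹) (-((((r - c : ℝ) : ℂ)) ^ 2)⁻¹) r := by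
  have hne : ((r : ℂ) - c) ≠ 0 := by
    rw [← Complex.ofReal_sub]
    exact_mod_cast (sub_pos.2 hr).ne'
  have h1 : HasDerivAt (fun z : ℂ => (z - c)⁻¹) (-(((r : ℂ) - c) ^ 2)⁻¹ * 1) (r : ℂ) :=
    (hasDerivAt_inv hne).comp (r : ℂ) ((hasDerivAt_id (r : ℂ)).sub_const (c : ℂ))
  have hfun : (fun x : ℝ => (((x - c : ℝ) : ℂ))⁻¹) = fun y : ℝ => ((y : ℂ) - c)⁻¹ := by
    funext y
    rw [Complex.ofReal_sub]
  rw [hfun]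
  refine h1.comp_ofReal.congr_deriv ?_
  rw [mul_one, ← Complex.ofReal_sub]

/-- `ψ' ` is the derivative of `ψ` on `(r₊, ∞)`. [cite: Costa2019, §3.2 (def-g-sub)] -/
theorem hasDerivAt_heunPsi (M a s ω m : ℝ) {r : ℝ} (hr : rPlus M a < r) :
    HasDerivAt (heunPsi M a s ω m) (heunPsiDeriv M a s ω m r) r := by
  have hq : rMinus M a < r := (rMinus_le_rPlus M a).trans_lt hr
  have hA := (hasDerivAt_ofReal_sub_inv (rMinus M a) hq).const_mul
    ((s : ℂ) - innerExponent M a ω m)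
  have hB := (hasDerivAt_ofReal_sub_inv (rPlus M a) hr).const_mul
    ((s : ℂ) - horizonExponent M a ω m)
  have h := (hA.add hB).add_const (I * ω)
  have hfun : heunPsi M a s ω m = fun x =>
      ((s : ℂ) - innerExponent M a ω m) * (((x - rMinus M a : ℝ) : ℂ))⁻¹ +
        ((s : ℂ) - horizonExponent M a ω m) * (((x - rPlus M a : ℝ) : ℂ))⁻¹ + I * ω := by
    funext x
    simp only [heunPsi, div_eq_mul_inv]
  rw [hfun]
  refine h.congr_deriv ?_
  simp only [heunPsiDeriv, div_eq_mul_inv]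
  ring

/-- `d/dr heunWeight = heunWeight · ψ` on `(r₊, ∞)`. [cite: Costa2019, §3.2 (def-g-sub)] -/
theorem hasDerivAt_heunWeight (M a s ω m : ℝ) {r : ℝ} (hr : rPlus M a < r) :
    HasDerivAt (heunWeight M a s ω m) (heunWeight M a s ω m r * heunPsi M a s ω m r) r := by
  have hq : rMinus M a < r := (rMinus_le_rPlus M a).trans_lt hr
  have hA := hasDerivAt_ofReal_sub_cpow (rMinus M a) ((s : ℂ) - innerExponent M a ω m) hq
  have hB := hasDerivAt_ofReal_sub_cpow (rPlus M a) ((s : ℂ) - horizonExponent M a ω m) hr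
  have hE : HasDerivAt (fun x : ℝ => Complex.exp (I * ω * x)) (Complex.exp (I * ω * r) * (I * ω))
      r := by
    have h1 : HasDerivAt (fun x : ℝ => I * ω * (x : ℂ)) (I * ω * (1 : ℝ)) r :=
      (hasDerivAt_id r).ofReal_comp.const_mul (I * ω)
    simpa using h1.cexp
  refine ((hA.mul hB).mul hE).congr_deriv ?_
  simp only [Pi.mul_apply, heunWeight, heunPsi]
  ring

/-! ### The two coefficient identities -/

/-- `2Δψ + P = 2(s+1)(r − M)`: the first-order coefficient of `𝒯_r g` reproduces that of the
radial ODE. [cite: Costa2019, §3.2.2 (confluent-operator)] -/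
theorem two_delta_mul_heunPsi_add_heunP {M a : ℝ} (hM : 0 < M) (ha : |a| < M) (s ω m : ℝ)
    {r : ℝ} (hr : rPlus M a < r) :
    2 * (delta M a r : ℂ) * heunPsi M a s ω m r + heunP M a s ω m r =
      2 * ((s + 1 : ℝ) : ℂ) * ((r - M : ℝ) : ℂ) := by
  have hq : rMinus M a < r := (rMinus_le_rPlus M a).trans_lt hr
  have h1 : (r : ℂ) - (rPlus M a : ℂ) ≠ 0 := by
    rw [← Complex.ofReal_sub]; exact_mod_cast (sub_pos.2 hr).ne'
  have h2 : (r : ℂ) - (rMinus M a : ℂ) ≠ 0 := by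
    rw [← Complex.ofReal_sub]; exact_mod_cast (sub_pos.2 hq).ne'
  have h3 : (rPlus M a : ℂ) - (rMinus M a : ℂ) ≠ 0 := by
    rw [← Complex.ofReal_sub]; exact_mod_cast (sub_pos.2 (IsSubextremal.rMinus_lt_rPlus ha)).ne'
  have hM2 : (M : ℂ) = ((rPlus M a : ℂ) + (rMinus M a : ℂ)) / 2 := by
    rw [← Complex.ofReal_add, rPlus_add_rMinus]
    push_cast
    ring
  unfold heunPsi heunP innerExponent
  rw [horizonExponent_eq hM ha, delta_eq_mul ha.le]
  push_cast
  rw [hM2]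
  field_simp
  ring

/-- `Δ(ψ' + ψ²) + Pψ + Q = V`, `V` the coefficient of `R` in the radial ODE
(`Kerr.IsRadialTeukolskySolution`): the zeroth-order coefficient of `𝒯_r g` reproduces the
radial potential. A rational identity once `r₊ + r₋ = 2M`, `r₊ r₋ = a²`,
`Δ = (r − r₊)(r − r₋)`. [cite: Costa2019, §3.2.2 (confluent-operator), corrected] -/
theorem heun_zeroth_order_identity {M a : ℝ} (hM : 0 < M) (ha : |a| < M) (s ω m lam : ℝ)
    {r : ℝ} (hr : rPlus M a < r) :
    (delta M a r : ℂ) * (heunPsiDeriv M a s ω m r + heunPsi M a s ω m r ^ 2) +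
        heunP M a s ω m r * heunPsi M a s ω m r + heunQ a s ω m lam r =
      (((radialK a ω m r ^ 2 : ℝ) : ℂ) -
            2 * I * (s : ℂ) * ((r - M : ℝ) : ℂ) * (radialK a ω m r : ℂ)) / (delta M a r : ℂ) +
        4 * I * (s : ℂ) * (ω : ℂ) * (r : ℂ) - (lam : ℂ) - ((a ^ 2 * ω ^ 2 : ℝ) : ℂ) +
        ((2 * a * m * ω : ℝ) : ℂ) := by
  have hq : rMinus M a < r := (rMinus_le_rPlus M a).trans_lt hr
  have h1 : (r : ℂ) - (rPlus M a : ℂ) ≠ 0 := by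
    rw [← Complex.ofReal_sub]; exact_mod_cast (sub_pos.2 hr).ne'
  have h2 : (r : ℂ) - (rMinus M a : ℂ) ≠ 0 := by
    rw [← Complex.ofReal_sub]; exact_mod_cast (sub_pos.2 hq).ne'
  have h3 : (rPlus M a : ℂ) - (rMinus M a : ℂ) ≠ 0 := by
    rw [← Complex.ofReal_sub]; exact_mod_cast (sub_pos.2 (IsSubextremal.rMinus_lt_rPlus ha)).ne'
  have hM2 : (M : ℂ) = ((rPlus M a : ℂ) + (rMinus M a : ℂ)) / 2 := by
    rw [← Complex.ofReal_add, rPlus_add_rMinus]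
    push_cast
    ring
  have ha2 : (a : ℂ) ^ 2 = (rPlus M a : ℂ) * (rMinus M a : ℂ) := by
    rw [← Complex.ofReal_mul, rPlus_mul_rMinus ha.le]
    push_cast
    ring
  unfold heunPsi heunPsiDeriv heunP heunQ innerExponent radialK
  rw [horizonExponent_eq hM ha, delta_eq_mul ha.le]
  push_cast
  rw [hM2, ha2]
  field_simp
  ring_nf
  simp only [Complex.I_sq]
  ring

/-! ### The Heun equation for `g = heunWeight · R` -/

/-- **The radial ODE in confluent Heun form** (TdC §3.2: "given the definition of `g`, since
`R` is a solution to the radial ODE, `g` satisfies `𝒯_r g = 0`"). For a classical solution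
`R` of the homogeneous radial Teukolsky ODE on `(r₊, ∞)` (`Kerr.IsRadialTeukolskySolution`),
`g = heunWeight · R` is twice differentiable at every `r > r₊`, with
`g' = w(R' + ψR)`, `g'' = w(R'' + 2ψR' + (ψ' + ψ²)R)`, and
`Δ g'' + P g' + Q g = 0` there. [cite: Costa2019, §3.2.2 (𝒯_r g = G with G = 0)] -/
theorem heunEquation_of_isRadialTeukolskySolution {M a s ω m lam : ℝ} (hM : 0 < M)
    (ha : |a| < M) {R : ℝ → ℂ} (hR : IsRadialTeukolskySolution M a s ω m lam R) :
    ∃ g₁ g₂ : ℝ → ℂ, ∀ r : ℝ, rPlus M a < r →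
      HasDerivAt (fun x => heunWeight M a s ω m x * R x) (g₁ r) r ∧ HasDerivAt g₁ (g₂ r) r ∧
        (delta M a r : ℂ) * g₂ r + heunP M a s ω m r * g₁ r +
          heunQ a s ω m lam r * (heunWeight M a s ω m r * R r) = 0 := by
  obtain ⟨R', R'', hR⟩ := hR
  refine ⟨fun r => heunWeight M a s ω m r * (R' r + heunPsi M a s ω m r * R r),
    fun r => heunWeight M a s ω m r * (R'' r + 2 * heunPsi M a s ω m r * R' r +
      (heunPsiDeriv M a s ω m r + heunPsi M a s ω m r ^ 2) * R r), fun r hr => ?_⟩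
  obtain ⟨hd1, hd2, hode⟩ := hR r hr
  have hwd := hasDerivAt_heunWeight M a s ω m hr
  have hψd := hasDerivAt_heunPsi M a s ω m hr
  refine ⟨(hwd.mul hd1).congr_deriv (by ring), ?_, ?_⟩
  · exact (hwd.mul (hd2.add (hψd.mul hd1))).congr_deriv (by
      simp only [Pi.add_apply, Pi.mul_apply]; ring)
  · have hc1 := two_delta_mul_heunPsi_add_heunP hM ha s ω m hr
    have hc2 := heun_zeroth_order_identity hM ha s ω m lam hr
    have key : (delta M a r : ℂ) * (heunWeight M a s ω m r * (R'' r +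
        2 * heunPsi M a s ω m r * R' r +
          (heunPsiDeriv M a s ω m r + heunPsi M a s ω m r ^ 2) * R r)) +
        heunP M a s ω m r * (heunWeight M a s ω m r * (R' r + heunPsi M a s ω m r * R r)) +
        heunQ a s ω m lam r * (heunWeight M a s ω m r * R r) =
      heunWeight M a s ω m r * ((delta M a r : ℂ) * R'' r +
        (2 * (delta M a r : ℂ) * heunPsi M a s ω m r + heunP M a s ω m r) * R' r +
        ((delta M a r : ℂ) * (heunPsiDeriv M a s ω m r + heunPsi M a s ω m r ^ 2) +
          heunP M a s ω m r * heunPsi M a s ω m r + heunQ a s ω m lam r) * R r) := by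
      ring
    rw [key, hc1, hc2, hode, mul_zero]

/-! ### The outgoing condition at `𝓗⁺` in terms of `g` -/

/-- `x ↦ (x − c)^p` (principal complex power) is `C^∞` on `(c, ∞)`. [folklore] -/
theorem contDiffOn_ofReal_sub_cpow (c : ℝ) (p : ℂ) :
    ContDiffOn ℝ ((⊤ : ℕ∞) : WithTop ℕ∞) (fun x : ℝ => ((x - c : ℝ) : ℂ) ^ p) (Ioi c) := by
  intro x hx
  have hpos : (0 : ℝ) < x - c := sub_pos.2 hx
  have hslit : (((x - c : ℝ) : ℂ)) ∈ slitPlane := Complex.ofReal_mem_slitPlane.2 hpos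
  have h1 : AnalyticAt ℂ (fun z : ℂ => z ^ p) ((x - c : ℝ) : ℂ) :=
    analyticAt_id.cpow analyticAt_const hslit
  have h3a : AnalyticAt ℝ (fun y : ℝ => y - c) x := analyticAt_id.sub analyticAt_const
  have h3 : AnalyticAt ℝ (fun y : ℝ => ((y - c : ℝ) : ℂ)) x :=
    AnalyticAt.comp (g := fun y : ℝ => (y : ℂ)) (f := fun y : ℝ => y - c) (x := x)
      (Complex.ofRealCLM.analyticAt (x - c)) h3a
  have h4 : AnalyticAt ℝ (fun y : ℝ => (((y - c : ℝ) : ℂ)) ^ p) x :=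
    AnalyticAt.comp (g := fun z : ℂ => z ^ p) (f := fun y : ℝ => ((y - c : ℝ) : ℂ)) (x := x)
      h1.restrictScalars h3
  exact h4.contDiffAt.contDiffWithinAt

/-- **The outgoing condition at the horizon in terms of `g`.** If `R` is outgoing at `𝓗⁺`
(`Kerr.IsOutgoingAtHorizon`: `R(r)(r − r₊)^{s−ξ}` agrees on `(r₊, r₊+ε)` with a function
smooth on `(r₊−ε, r₊+ε)`), then so does `g = heunWeight · R`:
`g = (r − r₋)^{s−η} e^{iωr} · [R (r − r₊)^{s−ξ}]` with the bracket smooth at `r₊` and the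
prefactor smooth near `r₊ > r₋` (TdC (g-bdry-sub): "`g(r) = Σ bₖ (r − r₊)ᵏ` as `r → r₊`",
here in `C^∞` form). [cite: Costa2019, §3.2 (g-bdry-sub)] -/
theorem heunWeight_mul_smooth_at_horizon {M a s ω m : ℝ} (ha : |a| < M) {R : ℝ → ℂ}
    (hR : IsOutgoingAtHorizon M a s ω m R) :
    ∃ ε : ℝ, 0 < ε ∧ ∃ F : ℝ → ℂ,
      ContDiffOn ℝ ((⊤ : ℕ∞) : WithTop ℕ∞) F (Ioo (rPlus M a - ε) (rPlus M a + ε)) ∧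
        ∀ r ∈ Ioo (rPlus M a) (rPlus M a + ε), heunWeight M a s ω m r * R r = F r := by
  obtain ⟨ε, hε, f, hf, hRf⟩ := hR
  have hgap : 0 < rPlus M a - rMinus M a := sub_pos.2 (IsSubextremal.rMinus_lt_rPlus ha)
  set ε' := min ε (rPlus M a - rMinus M a) with hε'
  have hε'pos : 0 < ε' := lt_min hε hgap
  have hε'le : ε' ≤ ε := min_le_left _ _
  have hε'le' : ε' ≤ rPlus M a - rMinus M a := min_le_right _ _
  refine ⟨ε', hε'pos, fun r => ((r - rMinus M a : ℝ) : ℂ) ^ ((s : ℂ) - innerExponent M a ω m) *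
    Complex.exp (I * ω * r) * f r, ?_, fun r hr => ?_⟩
  · have hsub : Ioo (rPlus M a - ε') (rPlus M a + ε') ⊆ Ioo (rPlus M a - ε) (rPlus M a + ε) :=
      Ioo_subset_Ioo (by linarith) (by linarith)
    have hsub' : Ioo (rPlus M a - ε') (rPlus M a + ε') ⊆ Ioi (rMinus M a) := fun x hx => by
      simp only [mem_Ioi]
      linarith [hx.1]
    refine ContDiffOn.mul (ContDiffOn.mul ?_ ?_) (hf.mono hsub)
    · exact (contDiffOn_ofReal_sub_cpow (rMinus M a) _).mono hsub'
    · have h : ContDiff ℝ ((⊤ : ℕ∞) : WithTop ℕ∞) fun x : ℝ => Complex.exp (I * ω * x) :=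
        Complex.contDiff_exp.comp (contDiff_const.mul Complex.ofRealCLM.contDiff)
      exact h.contDiffOn
  · have hr' : r ∈ Ioo (rPlus M a) (rPlus M a + ε) := ⟨hr.1, by linarith [hr.2]⟩
    show heunWeight M a s ω m r * R r = ((r - rMinus M a : ℝ) : ℂ) ^
      ((s : ℂ) - innerExponent M a ω m) * Complex.exp (I * ω * r) * f r
    rw [← hRf r hr']
    simp only [heunWeight]
    ring
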